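import Mathlib.Algebra.Polynomial.Eval.Defs
import Mathlib.Data.Nat.Log
import Mathlib.Data.Nat.Factorial.Basic
import Mathlib.Order.Filter.AtTopBot.Basic
import Mathlib.Tactic
import Literature.Computability.Complexity.Classes

/-!
# Window arithmetic for the symmetry budget `g = ⌊log₂ m⌋`

Negative lemmas (pure arithmetic) for crux `stmt-PneNP-10637` (`HamCompiles`, route
`PneNP/SymmetryBudget`; cdisprove seat `refuter-cdisprove-stmt-PneNP-10637-g2-0`, cycle 2; work
file `Cruxes/HamCompiles/Disproof.lean` §10). The two numbers behind the route's "window":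

* `two_pow_log_mul_log_pow_le`: `2^{⌊log₂ m⌋} · ⌊log₂ m⌋^a ≤ m^{a+1}` — gate families indexed by
  (subset of the free part) × (a-tuple of free vertices) are polynomial at the window, so every
  subset-indexed equivariant construction (Held–Karp, subset towers) is affordable there;
* `log_factorial_superpoly`: `⌊log₂ m⌋!` beats every polynomial infinitely often (along `m = 2^n`;
  `exists_factorial_gt` is the inequality `c · 2^{kn} + c < n!` for large `n`), hence
  `symmetrise_bound_superpoly`: no size bound of the shape `c · (⌊log₂ m⌋! · (s m + 1))`, `c ≥ 1`
  — the shape delivered by the support item `Symmetrise` (AND of the `g!` relabelled copies of a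
  general circuit) — is polynomially bounded. So the naive compilation
  `NP ⊆ P ⇒ HAM ∈ SIZE(poly) ⇒ symmetrise` proves the crux's conclusion exactly at budgets with
  `g! ≤ poly` (`Negative/BudgetScale.lean`, `conclAt_of_symmetrise`) and is dead BY COUNT at
  `g = ⌊log₂ m⌋`: a refuted proof strategy (not a refuted statement) recorded for the provers.
-/

-- `Summit.PneNP.PneNP.…` duplicates `PneNP` BY DESIGN (single-problem summit, D-0017); the Summits
-- library sets this option globally (lakefile), repeated here so a standalone `lean check` is warning-free.
set_option linter.dupNamespace false

namespace Summit.PneNP.PneNP.Theorems.HamCompiles.Negative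

open scoped Nat

/-- Subset-indexed gates fit the budget: `2^{⌊log₂ m⌋} ≤ m` for `m ≠ 0`. -/
theorem two_pow_log_le {m : ℕ} (hm : m ≠ 0) : 2 ^ Nat.log 2 m ≤ m := Nat.pow_log_le_self 2 hm

/-- `2^{⌊log₂ m⌋} · ⌊log₂ m⌋^a ≤ m^{a+1}` (`m ≠ 0`): subsets × `a`-tuples of the free part are
polynomially many at the window. -/
theorem two_pow_log_mul_log_pow_le {m : ℕ} (hm : m ≠ 0) (a : ℕ) :
    2 ^ Nat.log 2 m * Nat.log 2 m ^ a ≤ m ^ (a + 1) := by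
  have h1 : 2 ^ Nat.log 2 m ≤ m := two_pow_log_le hm
  have h2 : Nat.log 2 m ≤ m := (Nat.log_lt_self 2 hm).le
  calc 2 ^ Nat.log 2 m * Nat.log 2 m ^ a ≤ m * m ^ a :=
        Nat.mul_le_mul h1 (Nat.pow_le_pow_left h2 a)
    _ = m ^ (a + 1) := by ring

/-- Factorials beat `c · 2^{k n} + c` from some `n` on. -/
theorem exists_factorial_gt (c k : ℕ) : ∃ N : ℕ, ∀ n ≥ N, c * 2 ^ (k * n) + c < n ! := by
  -- `a + 1 = 2^(k+1)` and `n! ≥ (a+1)^(n-a) = 2^{(k+1)(n-a)}`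
  obtain ⟨a, ha⟩ : ∃ a : ℕ, a + 1 = 2 ^ (k + 1) :=
    ⟨2 ^ (k + 1) - 1, Nat.sub_add_cancel Nat.one_le_two_pow⟩
  refine ⟨a + (k * a + c + 1), fun n hn => ?_⟩
  obtain ⟨n', rfl⟩ : ∃ n', n = a + n' := ⟨n - a, by omega⟩
  have hn' : k * a + c + 1 ≤ n' := by omega
  have h1 : (a + 1) ^ n' ≤ (a + n')! :=
    le_trans (Nat.le_mul_of_pos_left _ (Nat.factorial_pos a)) Nat.factorial_mul_pow_le_factorial
  rw [ha, ← pow_mul] at h1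
  have h2 : c * 2 ^ (k * (a + n')) + c ≤ 2 * c * 2 ^ (k * (a + n')) := by
    have : 1 ≤ 2 ^ (k * (a + n')) := Nat.one_le_two_pow
    nlinarith
  have h3 : 2 * c < 2 ^ (c + 1) := by
    have := Nat.lt_two_pow_self (n := c)
    rw [pow_succ]
    omega
  have h4 : (c + 1) + k * (a + n') ≤ (k + 1) * n' := by
    have e1 : (k + 1) * n' = k * n' + n' := by ring
    have e2 : k * (a + n') = k * a + k * n' := by ring
    omega
  calc c * 2 ^ (k * (a + n')) + c ≤ 2 * c * 2 ^ (k * (a + n')) := h2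
    _ < 2 ^ (c + 1) * 2 ^ (k * (a + n')) :=
        Nat.mul_lt_mul_of_pos_right h3 (Nat.two_pow_pos _)
    _ = 2 ^ ((c + 1) + k * (a + n')) := (pow_add 2 _ _).symm
    _ ≤ 2 ^ ((k + 1) * n') := Nat.pow_le_pow_right (by norm_num) h4
    _ ≤ (a + n')! := h1

/-- **`⌊log₂ m⌋!` is superpolynomial**: every polynomial is beaten infinitely often (along the
powers of two). -/
theorem log_factorial_superpoly (p : Polynomial ℕ) :
    ∃ᶠ m in Filter.atTop, p.eval m < (Nat.log 2 m)! := by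
  obtain ⟨c, k, hck⟩ := Literature.Computability.Complexity.exists_eval_le_mul_pow_add p
  obtain ⟨N, hN⟩ := exists_factorial_gt c k
  rw [Filter.frequently_atTop]
  intro M
  refine ⟨2 ^ max M N, (le_max_left M N).trans Nat.lt_two_pow_self.le, ?_⟩
  rw [Nat.log_pow (by norm_num : 1 < 2)]
  calc p.eval (2 ^ max M N) ≤ c * (2 ^ max M N) ^ k + c := hck _
    _ = c * 2 ^ (k * max M N) + c := by rw [← pow_mul, Nat.mul_comm (max M N) k]
    _ < (max M N)! := hN _ (le_max_right M N)

/-- Equivalently: no polynomial eventually dominates `⌊log₂ m⌋!`. -/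
theorem not_log_factorial_polyBounded :
    ¬ ∃ p : Polynomial ℕ, ∀ᶠ m in Filter.atTop, (Nat.log 2 m)! ≤ p.eval m := by
  rintro ⟨p, hp⟩
  exact ((log_factorial_superpoly p).and_eventually hp).exists.elim fun m hm =>
    absurd hm.2 (not_le.2 hm.1)

/-- Hence NO `Symmetrise`-shaped size bound `c · (⌊log₂ m⌋! · (s m + 1))` (`c ≥ 1`, any general
sizes `s m`) is below a polynomial eventually: the `g!`-symmetrisation cannot deliver poly-size
Bud(m,⌊log₂ m⌋)-symmetric circuits, whatever poly-size general circuits `NP ⊆ P` provides. -/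
theorem symmetrise_bound_superpoly {c : ℕ} (hc : 0 < c) (s : ℕ → ℕ) (p : Polynomial ℕ) :
    ∃ᶠ m in Filter.atTop, p.eval m < c * ((Nat.log 2 m)! * (s m + 1)) :=
  (log_factorial_superpoly p).mono fun _ hm =>
    hm.trans_le ((Nat.le_mul_of_pos_right _ (Nat.succ_pos _)).trans
      (Nat.le_mul_of_pos_left _ hc))

end Summit.PneNP.PneNP.Theorems.HamCompiles.Negative
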